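import Literature.Geometry.Symplectic.OrigamiCutGlueForm
import HarnessLib

/-!
# The symplectic form of a cut piece, II: the glued form

Proofs companion of `OrigamiUnfolding.lean` (the named fact
`Literature.Geometry.Symplectic.exists_symplecticCutPieces_of_isOrigamiForm`, Cannas da
Silva–Guillemin–Pires, *Symplectic Origami*, IMRN 2011 = arXiv:0909.4065, Prop. 2.8), step (S3)
concluded.  For `D : CutCollarData M N` with its piece `D.Piece = V ∪_glue cutDisc δ` and the two
compatible forms `D.sideForm`, `D.discForm` of `OrigamiCutGlueForm.lean`:

* `D.pieceForm` — **the glued form** (push-forwards along the structure embeddings `inV`, `inB`,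
  equal on the overlap by the compatibility `discForm_glueFun_apply`): `isSmoothForm_pieceForm`,
  `isClosedForm_pieceForm`, `pieceForm_nondegenerate`, and its values on the images
  `pieceForm_inV_apply` (`= s`), `pieceForm_inB_apply` (`= Ω_Q`).

Everything here is proved; the definitions are explicit; no facts.

## References

* A. Cannas da Silva, V. Guillemin, A. R. Pires, *Symplectic Origami*, IMRN 2011 =
  arXiv:0909.4065, proof of Prop. 2.8. [CannasdasilvaGuilleminPires2010]
-/

noncomputable section

open scoped Manifold ContDiff Topology RealInnerProductSpace
open Set Function Filter TopologicalSpace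
open _root_.Topology
open Literature.Geometry.Kaehler Literature.Geometry.Manifold

namespace Literature.Geometry.Symplectic

namespace CutCollarData

universe u

variable {M : Type u} [TopologicalSpace M] [ChartedSpace (EuclideanSpace ℝ (Fin 4)) M]
  [IsManifold (𝓡 4) ∞ M]
  {N : Type} [TopologicalSpace N] [ChartedSpace (EuclideanSpace ℝ (Fin 3)) N]
  [IsManifold (𝓡 3) ∞ N] [T2Space N] [Nonempty N] [MulAction Circle N] (D : CutCollarData M N)

/-! ### The glued form -/

open Classical in
/-- **The symplectic form of the cut piece**: the push-forward of `s|_V` on the image of `V`,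
of the reduced form on the image of the disc bundle (equal on the overlap).
[cite: CannasdasilvaGuilleminPires2010, Prop. 2.8] -/
def pieceForm : MForm (𝓡 4) D.Piece ℝ 2 := fun p =>
  letI := D.csB
  if p ∈ range D.inV then (D.sideForm.pullback (𝓡 4) (Function.invFun D.inV)) p
  else (D.discForm.pullback (𝓡 4) (Function.invFun D.inB)) p

/-- On the image of `V` the glued form is the push-forward of the side form. [folklore] -/
theorem pieceForm_of_mem {p : D.Piece} (hp : p ∈ range D.inV) :
    D.pieceForm p = (D.sideForm.pullback (𝓡 4) (Function.invFun D.inV)) p := by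
  classical
  exact if_pos hp

/-- Inverse of `inV` is smooth at the image points. [folklore] -/
theorem contMDiffAt_invFun_inV (a : D.V) : ContMDiffAt (𝓡 4) (𝓡 4) ∞ (Function.invFun D.inV) (D.inV a) := by
  letI := D.csB
  haveI := isManifold_cutSpace D.smooth_act D.free_act
  exact Literature.Geometry.Symplectic.SmoothGlueData.contMDiffAt_invFun_inl D.glueData a

/-- Inverse of `inB` is smooth at the image points. [folklore] -/
theorem contMDiffAt_invFun_inB (b : D.B) :
    letI := D.csB; ContMDiffAt (𝓡 4) (𝓡 (3 + 1)) ∞ (Function.invFun D.inB) (D.inB b) := by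
  letI := D.csB
  haveI := isManifold_cutSpace D.smooth_act D.free_act
  exact Literature.Geometry.Symplectic.SmoothGlueData.contMDiffAt_invFun_inr D.glueData b

/-- `d(invFun inB) ∘ d(inV) = d(glue)` on the source. [folklore] -/
theorem mfderiv_invFun_inB_mfderiv_inV {a : D.V} (ha : a ∈ D.glueSource) (u : TangentSpace (𝓡 4) a) :
    letI := D.csB
    mfderiv (𝓡 4) (𝓡 (3 + 1)) (Function.invFun D.inB) (D.inV a) (mfderiv (𝓡 4) (𝓡 4) D.inV a u) =
      mfderiv (𝓡 4) (𝓡 (3 + 1)) D.glueFun a u := by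
  letI := D.csB
  haveI := isManifold_cutSpace D.smooth_act D.free_act
  -- `inV = inB ∘ glue` near `a`
  have hloc : D.inV =ᶠ[𝓝 a] (D.inB ∘ D.glueFun) := by
    filter_upwards [D.isOpen_glueSource.mem_nhds ha] with a' ha'
    exact (D.inB_glueFun ha').symm
  have hg : MDifferentiableAt (𝓡 4) (𝓡 (3 + 1)) D.glueFun a :=
    (D.contMDiffOn_glueFun.contMDiffAt (D.isOpen_glueSource.mem_nhds ha)).mdifferentiableAt (by simp)
  have hB : MDifferentiableAt (𝓡 (3 + 1)) (𝓡 4) D.inB (D.glueFun a) :=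
    (D.contMDiff_inB _).mdifferentiableAt (by simp)
  rw [hloc.mfderiv_eq, mfderiv_comp a hB hg]
  show mfderiv (𝓡 4) (𝓡 (3 + 1)) (Function.invFun D.inB) (D.inV a)
    (mfderiv (𝓡 (3 + 1)) (𝓡 4) D.inB (D.glueFun a) (mfderiv (𝓡 4) (𝓡 (3 + 1)) D.glueFun a u)) = _
  rw [← D.inB_glueFun ha]
  have hid := mfderiv_invFun_comp_mfderiv D.inB_injective D.contMDiff_inB D.contMDiffAt_invFun_inB (D.glueFun a)
  exact congrArg (fun L => L (mfderiv (𝓡 4) (𝓡 (3 + 1)) D.glueFun a u)) hid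

/-- **The two push-forwards agree on the overlap**, so the glued form is the push-forward of the
disc form on the whole image of the disc bundle. [cite: CannasdasilvaGuilleminPires2010, Prop. 2.8] -/
theorem pieceForm_inB (b : D.B) :
    letI := D.csB
    D.pieceForm (D.inB b) = (D.discForm.pullback (𝓡 4) (Function.invFun D.inB)) (D.inB b) := by
  letI := D.csB
  haveI := isManifold_cutSpace D.smooth_act D.free_act
  classical
  by_cases hp : D.inB b ∈ range D.inV
  · rw [D.pieceForm_of_mem hp]
    obtain ⟨a, ha⟩ := hp
    obtain ⟨hsrc, hglue⟩ := D.inV_eq_inB_iff.1 ha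
    subst hglue
    rw [← ha]
    -- evaluate on `d inV`-images
    have hsurj : Surjective (mfderiv (𝓡 4) (𝓡 4) D.inV a) := by
      intro W
      refine ⟨mfderiv (𝓡 4) (𝓡 4) (Function.invFun D.inV) (D.inV a) W, ?_⟩
      have hid := mfderiv_comp_mfderiv_invFun D.inV_injective D.isOpenEmbedding_inV.isOpenMap D.contMDiff_inV
        D.contMDiffAt_invFun_inV a
      exact congrArg (fun L => L W) hid
    ext W
    have hpair : W = ![W 0, W 1] := by funext i; fin_cases i <;> rfl
    obtain ⟨u, hu⟩ := hsurj (W 0)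
    obtain ⟨u', hu'⟩ := hsurj (W 1)
    rw [hpair, ← hu, ← hu', MForm.pullback_apply, MForm.pullback_apply]
    have hvA : (fun i : Fin 2 => mfderiv (𝓡 4) (𝓡 4) (Function.invFun D.inV) (D.inV a)
        (![mfderiv (𝓡 4) (𝓡 4) D.inV a u, mfderiv (𝓡 4) (𝓡 4) D.inV a u'] i)) = ![u, u'] := by
      have hid := mfderiv_invFun_comp_mfderiv D.inV_injective D.contMDiff_inV D.contMDiffAt_invFun_inV a
      funext i; fin_cases i
      · exact congrArg (fun L => L u) hid
      · exact congrArg (fun L => L u') hid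
    have hvB : (fun i : Fin 2 => mfderiv (𝓡 4) (𝓡 (3 + 1)) (Function.invFun D.inB) (D.inV a)
        (![mfderiv (𝓡 4) (𝓡 4) D.inV a u, mfderiv (𝓡 4) (𝓡 4) D.inV a u'] i)) =
        ![mfderiv (𝓡 4) (𝓡 (3 + 1)) D.glueFun a u, mfderiv (𝓡 4) (𝓡 (3 + 1)) D.glueFun a u'] := by
      funext i; fin_cases i
      · exact D.mfderiv_invFun_inB_mfderiv_inV hsrc u
      · exact D.mfderiv_invFun_inB_mfderiv_inV hsrc u'
    rw [hvA, hvB, MForm.apply_congr_point' D.sideForm (Function.leftInverse_invFun D.inV_injective a),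
      show Function.invFun D.inB (D.inV a) = D.glueFun a by
        rw [← D.inB_glueFun hsrc, Function.leftInverse_invFun D.inB_injective],
      D.discForm_glueFun_apply hsrc]
  · exact if_neg hp

/-- **The glued form is smooth.** [cite: CannasdasilvaGuilleminPires2010, Prop. 2.8] -/
theorem isSmoothForm_pieceForm : IsSmoothForm D.pieceForm := by
  letI := D.csB
  haveI := isManifold_cutSpace D.smooth_act D.free_act
  intro p
  rcases D.exists_inV_or_inB p with ⟨a, rfl⟩ | ⟨b, rfl⟩
  · haveI : Nonempty D.V := ⟨a⟩
    have hev : ∀ᶠ p in 𝓝 (D.inV a), (D.sideForm.pullback (𝓡 4) (Function.invFun D.inV)) p = D.pieceForm p := by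
      filter_upwards [D.isOpenEmbedding_inV.isOpen_range.mem_nhds (mem_range_self a)] with p hp
      exact (D.pieceForm_of_mem hp).symm
    exact (smoothAt_pullback_invFun D.inV_injective D.isOpenEmbedding_inV.isOpenMap D.contMDiffAt_invFun_inV
      (D.isSmoothForm_sideForm a)).congr_of_eventuallyEq hev
  · haveI : Nonempty D.B := ⟨b⟩
    have hev : ∀ᶠ p in 𝓝 (D.inB b), (D.discForm.pullback (𝓡 4) (Function.invFun D.inB)) p = D.pieceForm p := by
      filter_upwards [D.isOpenEmbedding_inB.isOpen_range.mem_nhds (mem_range_self b)] with p hp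
      obtain ⟨b', rfl⟩ := hp
      exact (D.pieceForm_inB b').symm
    exact (smoothAt_pullback_invFun D.inB_injective D.isOpenEmbedding_inB.isOpenMap D.contMDiffAt_invFun_inB
      (D.isSmoothForm_discForm b)).congr_of_eventuallyEq hev

/-- **The glued form is closed.** [cite: CannasdasilvaGuilleminPires2010, Prop. 2.8] -/
theorem isClosedForm_pieceForm : IsClosedForm D.pieceForm := by
  letI := D.csB
  haveI := isManifold_cutSpace D.smooth_act D.free_act
  show mextDeriv D.pieceForm = 0
  funext p
  rcases D.exists_inV_or_inB p with ⟨a, rfl⟩ | ⟨b, rfl⟩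
  · haveI : Nonempty D.V := ⟨a⟩
    have hev : ∀ᶠ p in 𝓝 (D.inV a), D.pieceForm p = (D.sideForm.pullback (𝓡 4) (Function.invFun D.inV)) p := by
      filter_upwards [D.isOpenEmbedding_inV.isOpen_range.mem_nhds (mem_range_self a)] with p hp
      exact D.pieceForm_of_mem hp
    rw [mextDeriv_congr_of_eventuallyEq hev, mextDeriv_pullback_invFun D.inV_injective
      D.isOpenEmbedding_inV.isOpenMap D.contMDiffAt_invFun_inV (D.isSmoothForm_sideForm a)]
    have h0 : mextDeriv D.sideForm = 0 := D.isClosedForm_sideForm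
    rw [h0, MForm.pullback_zero]
  · haveI : Nonempty D.B := ⟨b⟩
    have hev : ∀ᶠ p in 𝓝 (D.inB b), D.pieceForm p = (D.discForm.pullback (𝓡 4) (Function.invFun D.inB)) p := by
      filter_upwards [D.isOpenEmbedding_inB.isOpen_range.mem_nhds (mem_range_self b)] with p hp
      obtain ⟨b', rfl⟩ := hp
      exact D.pieceForm_inB b'
    rw [mextDeriv_congr_of_eventuallyEq hev, mextDeriv_pullback_invFun D.inB_injective
      D.isOpenEmbedding_inB.isOpenMap D.contMDiffAt_invFun_inB (D.isSmoothForm_discForm b)]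
    have h0 : mextDeriv D.discForm = 0 := D.isClosedForm_discForm
    rw [h0, MForm.pullback_zero]

/-- **Values of the glued form on `d(inV)`-images: the form `s`.** [folklore] -/
theorem pieceForm_inV_apply (a : D.V) (v : Fin 2 → TangentSpace (𝓡 4) a) :
    D.pieceForm (D.inV a) (fun i => mfderiv (𝓡 4) (𝓡 4) D.inV a (v i)) = D.s (a : M) v := by
  rw [D.pieceForm_of_mem (mem_range_self a)]
  have h := pullback_pullback_invFun_apply D.inV_injective D.contMDiff_inV D.contMDiffAt_invFun_inV
    D.sideForm a
  have h' := congrArg (fun φ => φ v) h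
  rw [MForm.pullback_apply] at h'
  rw [h', sideForm_apply]

/-- **Values of the glued form on `d(inB)`-images: the reduced form.** [folklore] -/
theorem pieceForm_inB_apply (b : D.B) (v : letI := D.csB; Fin 2 → TangentSpace (𝓡 (3 + 1)) b) :
    letI := D.csB
    D.pieceForm (D.inB b) (fun i => mfderiv (𝓡 (3 + 1)) (𝓡 4) D.inB b (v i)) = D.redForm (b : CutSpace 3 N) v := by
  letI := D.csB
  haveI := isManifold_cutSpace D.smooth_act D.free_act
  rw [D.pieceForm_inB b]
  have h := pullback_pullback_invFun_apply D.inB_injective D.contMDiff_inB D.contMDiffAt_invFun_inB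
    D.discForm b
  have h' := congrArg (fun φ => φ v) h
  rw [MForm.pullback_apply] at h'
  rw [h', discForm_apply]

/-- **The glued form is non-degenerate.** [cite: CannasdasilvaGuilleminPires2010, Prop. 2.8] -/
theorem pieceForm_nondegenerate (p : D.Piece) (W : TangentSpace (𝓡 4) p) (hW : W ≠ 0) :
    ∃ W' : TangentSpace (𝓡 4) p, D.pieceForm p ![W, W'] ≠ 0 := by
  letI := D.csB
  haveI := isManifold_cutSpace D.smooth_act D.free_act
  rcases D.exists_inV_or_inB p with ⟨a, rfl⟩ | ⟨b, rfl⟩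
  · haveI : Nonempty D.V := ⟨a⟩
    have hsurj : Surjective (mfderiv (𝓡 4) (𝓡 4) D.inV a) := fun W =>
      ⟨_, congrArg (fun L => L W) (mfderiv_comp_mfderiv_invFun D.inV_injective
        D.isOpenEmbedding_inV.isOpenMap D.contMDiff_inV D.contMDiffAt_invFun_inV a)⟩
    obtain ⟨u, rfl⟩ := hsurj W
    have hu : u ≠ 0 := fun h => hW (by rw [h, map_zero])
    obtain ⟨u', hu'⟩ := D.sideForm_nondegenerate a u hu
    refine ⟨mfderiv (𝓡 4) (𝓡 4) D.inV a u', ?_⟩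
    have h := D.pieceForm_inV_apply a ![u, u']
    have hvec : (fun i : Fin 2 => mfderiv (𝓡 4) (𝓡 4) D.inV a (![u, u'] i)) =
        ![mfderiv (𝓡 4) (𝓡 4) D.inV a u, mfderiv (𝓡 4) (𝓡 4) D.inV a u'] := by
      funext i; fin_cases i <;> rfl
    rw [hvec] at h
    rw [h, ← sideForm_apply]
    exact hu'
  · haveI : Nonempty D.B := ⟨b⟩
    have hsurj : Surjective (mfderiv (𝓡 (3 + 1)) (𝓡 4) D.inB b) := fun W =>
      ⟨_, congrArg (fun L => L W) (mfderiv_comp_mfderiv_invFun D.inB_injective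
        D.isOpenEmbedding_inB.isOpenMap D.contMDiff_inB D.contMDiffAt_invFun_inB b)⟩
    obtain ⟨u, rfl⟩ := hsurj W
    have hu : u ≠ 0 := fun h => hW (by rw [h, map_zero])
    obtain ⟨u', hu'⟩ := D.discForm_nondegenerate b u hu
    refine ⟨mfderiv (𝓡 (3 + 1)) (𝓡 4) D.inB b u', ?_⟩
    have h := D.pieceForm_inB_apply b ![u, u']
    have hvec : (fun i : Fin 2 => mfderiv (𝓡 (3 + 1)) (𝓡 4) D.inB b (![u, u'] i)) =
        ![mfderiv (𝓡 (3 + 1)) (𝓡 4) D.inB b u, mfderiv (𝓡 (3 + 1)) (𝓡 4) D.inB b u'] := by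
      funext i; fin_cases i <;> rfl
    rw [hvec] at h
    rw [h, ← discForm_apply]
    exact hu'

end CutCollarData

end Literature.Geometry.Symplectic

end
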